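import Summits.MatrixMultiplication.MatrixMultiplication.Theorems.SoloInformedValLabelPacking

/-!
# The aligned `K_{2,2}` grid: label budget `Σ|L_t| ≤ |Λ|` (solo-informed gen 87, CLAIMS c661 / c659)

Continuation of `SoloInformedValLabelPacking` (the GENERIC common-quotient regime, `2·Σ|L_t| ≤ |Λ|`).  In the simplest ALIGNED
pattern — four blocks sitting in the cells of a `2 × 2` grid, blocks in the same row sharing their `B`-direction and blocks in
the same column sharing their `C`-direction (`R_{ij} = U_i ⊕ W_j`, dossier §15.8 (n)(xxv), `work/g87/cyc/CYC.md` §5–§6) — the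
cross conditions that survive as label conditions are: (Q2) for every pair, (Z) for pairs in different columns, (Y) for pairs
in different rows, and (P5)(t,u,b) unless `b` is the cell (row t, column u).  The label count then allows twice as much as in
the generic regime, and this is sharp in the count (ratio 1 is attained by label systems; `gridlam.py`).

* `cell_label_ineq` — the ALIGNED CELL PACKING: for a cell `a` with row-neighbour `c`, column-neighbour `c'` and diagonal
  cell `b`, the four translates `L_a + λ_a`, `L_a + λ_b`, `μ_a + L_c^z`, `λ_a + μ_a + L_{c'}^y` are pairwise disjoint, so
  `2|L_a| + |L_c| + |L_{c'}| ≤ |Λ|` (six surviving conditions are used, each once).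
* `sum_card_le_of_K22_labels` — summing the four cell inequalities: `|L_p| + |L_q| + |L_r| + |L_s| ≤ |Λ|` for the grid
  `p q / r s`.  With `|Λ| = 2^q` this is `T ≤ n` for every design of this pattern (the (PT) bound, tight in the count).
-/

namespace Summit.MatrixMultiplication.MatrixMultiplication.Theorems.SoloVal

open Finset

section GridK22

variable {G : Type*} [AddCommGroup G] [DecidableEq G]

/-- ALIGNED CELL PACKING.  Cell `a`, row-neighbour `c` (other column), column-neighbour `c'` (other row), diagonal `b`.
Hypotheses = the six label conditions that survive the alignments: (Q2)(a;b), (Z)(a,c), (Y)(a,c'), (P5)(a,c,b), (P5)(c',a,b),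
(P5)(c',c,a).  Conclusion: `2|L_a| + |L_c| + |L_{c'}| ≤ |Λ|`. -/
theorem cell_label_ineq [Fintype G] (h2 : ∀ g : G, g + g = 0) (La Lc Lc' : Finset G)
    (lam_a lam_b lam_c mu_a mu_c mu_c' : G)
    (hQ2 : ∀ ℓ ∈ La, ∀ ℓ' ∈ La, ℓ + ℓ' ≠ lam_a + lam_b)
    (hZ : ∀ ℓ ∈ La, ∀ ℓ' ∈ Lc, ℓ + ℓ' ≠ lam_a + mu_a + lam_c + mu_c)
    (hY : ∀ ℓ ∈ La, ∀ ℓ' ∈ Lc', ℓ + ℓ' ≠ mu_a + mu_c')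
    (hP5acb : ∀ ℓ ∈ La, ∀ ℓ' ∈ Lc, ℓ + ℓ' ≠ mu_a + lam_c + mu_c + lam_b)
    (hP5c'ab : ∀ ℓ ∈ Lc', ∀ ℓ' ∈ La, ℓ + ℓ' ≠ mu_c' + lam_a + mu_a + lam_b)
    (hP5c'ca : ∀ ℓ ∈ Lc', ∀ ℓ' ∈ Lc, ℓ + ℓ' ≠ mu_c' + lam_c + mu_c + lam_a) :
    2 * La.card + Lc.card + Lc'.card ≤ Fintype.card G := by
  classical
  have dd : ∀ (x y d : G), x = y + (d + d) → x = y := fun x y d h => by rw [h, h2, add_zero]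
  -- the four translates
  set M := labelShift La lam_a with hM
  set U := labelShift La lam_b with hU
  set V := labelShift Lc (mu_a + lam_c + mu_c) with hV
  set W := labelShift Lc' (lam_a + mu_a + mu_c') with hW
  have dMU : Disjoint M U := disjoint_labelShift h2 (fun ℓ hℓ ℓ' hℓ' h => hQ2 ℓ hℓ ℓ' hℓ' h)
  have dMV : Disjoint M V := disjoint_labelShift h2 (fun ℓ hℓ ℓ' hℓ' h =>
    hZ ℓ hℓ ℓ' hℓ' (by rw [h]; try abel))
  have dMW : Disjoint M W := disjoint_labelShift h2 (fun ℓ hℓ ℓ' hℓ' h =>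
    hY ℓ hℓ ℓ' hℓ' (dd _ _ lam_a (by rw [h]; try abel)))
  have dUV : Disjoint U V := disjoint_labelShift h2 (fun ℓ hℓ ℓ' hℓ' h =>
    hP5acb ℓ hℓ ℓ' hℓ' (by rw [h]; try abel))
  have dUW : Disjoint U W := disjoint_labelShift h2 (fun ℓ hℓ ℓ' hℓ' h =>
    hP5c'ab ℓ' hℓ' ℓ hℓ (by rw [add_comm ℓ' ℓ, h]; try abel))
  have dVW : Disjoint V W := disjoint_labelShift h2 (fun ℓ hℓ ℓ' hℓ' h =>
    hP5c'ca ℓ' hℓ' ℓ hℓ (dd _ _ mu_a (by rw [add_comm ℓ' ℓ, h]; try abel)))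
  have cM : M.card = La.card := card_labelShift _ _
  have cU : U.card = La.card := card_labelShift _ _
  have cV : V.card = Lc.card := card_labelShift _ _
  have cW : W.card = Lc'.card := card_labelShift _ _
  have c1 : (M ∪ U).card = 2 * La.card := by rw [card_union_of_disjoint dMU, cM, cU]; ring
  have c2 : (V ∪ W).card = Lc.card + Lc'.card := by rw [card_union_of_disjoint dVW, cV, cW]
  have d12 : Disjoint (M ∪ U) (V ∪ W) :=
    disjoint_union_left.2 ⟨disjoint_union_right.2 ⟨dMV, dMW⟩, disjoint_union_right.2 ⟨dUV, dUW⟩⟩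
  calc 2 * La.card + Lc.card + Lc'.card = ((M ∪ U) ∪ (V ∪ W)).card := by
        rw [card_union_of_disjoint d12, c1, c2]; ring
    _ ≤ Fintype.card G := card_le_univ _

/-- THE `K_{2,2}` GRID BOUND.  Four blocks `p q / r s` (rows `{p,q}`, `{r,s}`; columns `{p,r}`, `{q,s}`) with label sets
`L_p … L_s`, block labels `λ`, `μ`.  Surviving conditions: (Q2) on the diagonals, (Z) across columns, (Y) across rows, and the
non-escaping (P5) triples.  Then `|L_p| + |L_q| + |L_r| + |L_s| ≤ |Λ|` — i.e. `T ≤ n` for this aligned pattern. -/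
theorem sum_card_le_of_K22_labels [Fintype G] (h2 : ∀ g : G, g + g = 0) (Lp Lq Lr Ls : Finset G)
    (lp lq lr ls mp mq mr ms : G)
    -- (Q2) on the two diagonals (both orientations)
    (hQ2ps : ∀ ℓ ∈ Lp, ∀ ℓ' ∈ Lp, ℓ + ℓ' ≠ lp + ls) (hQ2sp : ∀ ℓ ∈ Ls, ∀ ℓ' ∈ Ls, ℓ + ℓ' ≠ ls + lp)
    (hQ2qr : ∀ ℓ ∈ Lq, ∀ ℓ' ∈ Lq, ℓ + ℓ' ≠ lq + lr) (hQ2rq : ∀ ℓ ∈ Lr, ∀ ℓ' ∈ Lr, ℓ + ℓ' ≠ lr + lq)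
    -- (Z) for pairs in different columns
    (hZpq : ∀ ℓ ∈ Lp, ∀ ℓ' ∈ Lq, ℓ + ℓ' ≠ lp + mp + lq + mq) (hZqp : ∀ ℓ ∈ Lq, ∀ ℓ' ∈ Lp, ℓ + ℓ' ≠ lq + mq + lp + mp)
    (hZrs : ∀ ℓ ∈ Lr, ∀ ℓ' ∈ Ls, ℓ + ℓ' ≠ lr + mr + ls + ms) (hZsr : ∀ ℓ ∈ Ls, ∀ ℓ' ∈ Lr, ℓ + ℓ' ≠ ls + ms + lr + mr)
    -- (Y) for pairs in different rows
    (hYpr : ∀ ℓ ∈ Lp, ∀ ℓ' ∈ Lr, ℓ + ℓ' ≠ mp + mr) (hYrp : ∀ ℓ ∈ Lr, ∀ ℓ' ∈ Lp, ℓ + ℓ' ≠ mr + mp)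
    (hYqs : ∀ ℓ ∈ Lq, ∀ ℓ' ∈ Ls, ℓ + ℓ' ≠ mq + ms) (hYsq : ∀ ℓ ∈ Ls, ∀ ℓ' ∈ Lq, ℓ + ℓ' ≠ ms + mq)
    -- the twelve non-escaping (P5) triples (t,u,b): value μ_t + λ_u + μ_u + λ_b
    (hP5pqs : ∀ ℓ ∈ Lp, ∀ ℓ' ∈ Lq, ℓ + ℓ' ≠ mp + lq + mq + ls) (hP5rps : ∀ ℓ ∈ Lr, ∀ ℓ' ∈ Lp, ℓ + ℓ' ≠ mr + lp + mp + ls)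
    (hP5rqp : ∀ ℓ ∈ Lr, ∀ ℓ' ∈ Lq, ℓ + ℓ' ≠ mr + lq + mq + lp)
    (hP5qpr : ∀ ℓ ∈ Lq, ∀ ℓ' ∈ Lp, ℓ + ℓ' ≠ mq + lp + mp + lr) (hP5sqr : ∀ ℓ ∈ Ls, ∀ ℓ' ∈ Lq, ℓ + ℓ' ≠ ms + lq + mq + lr)
    (hP5spq : ∀ ℓ ∈ Ls, ∀ ℓ' ∈ Lp, ℓ + ℓ' ≠ ms + lp + mp + lq)
    (hP5rsq : ∀ ℓ ∈ Lr, ∀ ℓ' ∈ Ls, ℓ + ℓ' ≠ mr + ls + ms + lq) (hP5prq : ∀ ℓ ∈ Lp, ∀ ℓ' ∈ Lr, ℓ + ℓ' ≠ mp + lr + mr + lq)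
    (hP5psr : ∀ ℓ ∈ Lp, ∀ ℓ' ∈ Ls, ℓ + ℓ' ≠ mp + ls + ms + lr)
    (hP5srp : ∀ ℓ ∈ Ls, ∀ ℓ' ∈ Lr, ℓ + ℓ' ≠ ms + lr + mr + lp) (hP5qsp : ∀ ℓ ∈ Lq, ∀ ℓ' ∈ Ls, ℓ + ℓ' ≠ mq + ls + ms + lp)
    (hP5qrs : ∀ ℓ ∈ Lq, ∀ ℓ' ∈ Lr, ℓ + ℓ' ≠ mq + lr + mr + ls) :
    Lp.card + Lq.card + Lr.card + Ls.card ≤ Fintype.card G := by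
  -- cell p: row-neighbour q, column-neighbour r, diagonal s
  have h1 := cell_label_ineq h2 Lp Lq Lr lp ls lq mp mq mr hQ2ps hZpq hYpr hP5pqs hP5rps hP5rqp
  -- cell q: row-neighbour p, column-neighbour s, diagonal r
  have h2' := cell_label_ineq h2 Lq Lp Ls lq lr lp mq mp ms hQ2qr hZqp hYqs hP5qpr hP5sqr hP5spq
  -- cell r: row-neighbour s, column-neighbour p, diagonal q
  have h3 := cell_label_ineq h2 Lr Ls Lp lr lq ls mr ms mp hQ2rq hZrs hYrp hP5rsq hP5prq hP5psr
  -- cell s: row-neighbour r, column-neighbour q, diagonal p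
  have h4 := cell_label_ineq h2 Ls Lr Lq ls lp lr ms mr mq hQ2sp hZsr hYsq hP5srp hP5qsp hP5qrs
  omega

end GridK22

end Summit.MatrixMultiplication.MatrixMultiplication.Theorems.SoloVal
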